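import Mathlib.MeasureTheory.Measure.Prokhorov
import Mathlib.MeasureTheory.Constructions.Polish.Basic
import Mathlib.MeasureTheory.Function.ConvergenceInDistribution
import Literature.Probability.Process.PathSpaceBorel
import Literature.Probability.RandomPlanarGeometry.SLETraceEightKernel
import HarnessLib

/-!
# The limit argument of [LSW04] Thm. 4.7: an approximation criterion for the SLE_κ trace

Trunk T-STOCH, tenure file of the named fact `Literature.Probability.RandomPlanarGeometry.hasSLETrace_eight`
(chordal SLE₈ is a.s. generated by a curve — Lawler–Schramm–Werner, Ann. Probab. 32 (2004),
Thm. 4.7). The printed proof (p. 981) runs: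

> "First, note that the family of laws of `γ̂` is tight [Prop. 4.5 + Arzelà–Ascoli]. Also,
> Theorem 4.4 implies that the law of `W` converges weakly to the law of `B(8t)`. Hence, there
> is a subsequence such that the law of the pair `(γ̂, W)` converges weakly to some probability
> measure `μ`. Let `(γ*, W*)` be random with law `μ`. Then we may identify `W*(t)` with `B(8t)`.
> By the chordal analog of Lemma 3.14, it follows that, for all `t > 0`, `gₜ⁻¹(ℍ)` is the
> unbounded component of `ℍ ∖ γ*[0, t]`" … "This proves Theorem 4.7."

This file PROVES that limit argument in abstract form, for every `κ`
(`Literature.Probability.RandomPlanarGeometry.hasSLETrace_of_tendstoInDistribution`): **if on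
some probability spaces there are random continuous curves `Γₙ` and random continuous driving
functions `Ξₙ` such that a.s. the Loewner chain of `Ξₙ` is generated by `Γₙ`, the laws of the
`Γₙ` are tight on `C([0, ∞), ℂ)` and `Ξₙ → √κ B` in distribution on `C([0, ∞), ℝ)` (the SLE_κ
driving path of `SLE.lean`), then SLE_κ is generated by a curve (`HasSLETrace κ`).** With the
UST Peano curves of [LSW04] §4.1 as `Γₙ` (tightness: Prop. 4.5; driving convergence: Thm. 4.4)
and `κ = 8` this is exactly the printed proof of Thm. 4.7 = `hasSLETrace_eight`; those two
probabilistic inputs are the remaining (XL) debt of that fact.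

Ingredients, all proved: the Borel σ-algebra of path space is generated by evaluations
(`PathSpaceBorel`, so the driving path `ω ↦ √κ B(ω)` is a random element of `C([0, ∞), ℝ)`,
`measurable_drivingPath`); the set of pairs `(γ, W)` with chain`(W)` generated by `γ` is
**closed** in `C × C` (`isClosed_generatedPairs` — Lemma 3.14 (i)+(ii), `SLETraceEight`,
`SLETraceEightKernel`); Prokhorov's theorem (Mathlib `isCompact_closure_of_isTightMeasureSet`,
joint tightness from the marginals `IsTightMeasureSet.prodMk`, tightness of the convergent
driving laws by the converse `isTightMeasureSet_of_isCompact_closure` on the Polish path space);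
the portmanteau theorem (`ProbabilityMeasure.limsup_measure_closed_le_of_tendsto`) giving
`μ(A) = 1`; and — replacing "let `(γ*, W*)` be random with law `μ`" — the Lusin–Souslin theorem
(Mathlib `MeasurableSet.image_of_measurable_injOn`): the projection of the closed set `A` to the
driving coordinate is injective (the generating curve is unique,
`Loewner.IsGeneratedByCurve.unique_holds`), hence Borel, of full measure for the law of `√κ B`,
which transports to the canonical space (`ae_of_ae_map`).

The Borel σ-algebras on `C(ℝ≥0, ℂ)`, `C(ℝ≥0, ℝ)` are scoped instances (namespace
`Literature.Probability.RandomPlanarGeometry.PathBorel`; Mathlib has none on `C(X, Y)`).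

## References

* G. F. Lawler, O. Schramm, W. Werner, *Conformal invariance of planar loop-erased random walks
  and uniform spanning trees*, Ann. Probab. 32 (2004) 939–995, proof of Thms. 4.7/4.8, p. 981.
* P. Billingsley, *Convergence of Probability Measures* (2nd ed. 1999), Thms. 2.1, 5.1, 5.2, §7.
* A. S. Kechris, *Classical Descriptive Set Theory* (1995), Thm. 15.1 (Lusin–Souslin).
-/

noncomputable section

open Set Filter Topology Metric MeasureTheory TopologicalSpace
open scoped NNReal

namespace Literature.Probability.RandomPlanarGeometry

/-! ### Borel structures on the two path spaces (scoped) -/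

namespace PathBorel

/-- Borel σ-algebra on the curve space `C([0, ∞), ℂ)` (compact-open topology). [folklore] -/
scoped instance instMeasurableSpaceCurvePath : MeasurableSpace C(ℝ≥0, ℂ) := borel _

/-- `C([0, ∞), ℂ)` with its Borel σ-algebra is a Borel space. [folklore] -/
scoped instance instBorelSpaceCurvePath : BorelSpace C(ℝ≥0, ℂ) := ⟨rfl⟩

/-- Borel σ-algebra on the driving-path space `C([0, ∞), ℝ)` (compact-open topology). [folklore] -/
scoped instance instMeasurableSpaceDrivingPath : MeasurableSpace C(ℝ≥0, ℝ) := borel _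

/-- `C([0, ∞), ℝ)` with its Borel σ-algebra is a Borel space. [folklore] -/
scoped instance instBorelSpaceDrivingPath : BorelSpace C(ℝ≥0, ℝ) := ⟨rfl⟩

end PathBorel

open scoped PathBorel

/-! ### The SLE_κ driving path as a random element of path space -/

section DrivingPath

variable (κ : ℝ≥0)

/-- The **SLE_κ driving path** `ω ↦ (t ↦ √κ Bₜ(ω)) ∈ C([0, ∞), ℝ)`: the driving function
`sleDriving κ ω` of `SLE.lean`, bundled as a continuous map (paths of the canonical Brownian
motion are continuous by construction). Rohde–Schramm (2005), §1; [LSW04] Thm. 4.7 ("driven by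
`B(8t)`", same law as `√8 B(t)`). [cite: LawlerSchrammWerner2004, Thm. 4.7] -/
def drivingPath (ω : ℝ≥0 → ℝ) : C(ℝ≥0, ℝ) :=
  ⟨sleDriving κ ω, continuous_sleDriving κ ω⟩

/-- `drivingPath κ ω t = sleDriving κ ω t`. [folklore] -/
@[simp]
theorem drivingPath_apply (ω : ℝ≥0 → ℝ) (t : ℝ≥0) : drivingPath κ ω t = sleDriving κ ω t := rfl

/-- The underlying function of `drivingPath κ ω` is `sleDriving κ ω`. [folklore] -/
theorem coe_drivingPath (ω : ℝ≥0 → ℝ) : ⇑(drivingPath κ ω) = sleDriving κ ω := rfl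

/-- **The driving path is a random element of `C([0, ∞), ℝ)`** (Borel measurable), since each
marginal is measurable and the Borel σ-algebra of path space is generated by the evaluations
(`Process.measurable_continuousMap_of_eval`). Billingsley (1999), §7. [cite: Billingsley1999, §7] -/
@[fun_prop]
theorem measurable_drivingPath : Measurable (drivingPath κ) :=
  Process.measurable_continuousMap_of_eval fun t ↦ measurable_sleDriving κ t

end DrivingPath

/-! ### The closed set of generated pairs -/

/-- The set of pairs `(γ, W) ∈ C([0, ∞), ℂ) × C([0, ∞), ℝ)` such that the chordal Loewner chain
driven by `W` is generated by the curve `γ` — the set on which [LSW04] (proof of Thm. 4.7,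
p. 981, via Lemma 3.14) put the subsequential limit law. [cite: LawlerSchrammWerner2004, Lemma 3.14] -/
def generatedPairs : Set (C(ℝ≥0, ℂ) × C(ℝ≥0, ℝ)) :=
  {p | Loewner.IsGeneratedByCurve p.2 p.1}

/-- Membership in `generatedPairs`. [folklore] -/
@[simp]
theorem mem_generatedPairs {p : C(ℝ≥0, ℂ) × C(ℝ≥0, ℝ)} :
    p ∈ generatedPairs ↔ Loewner.IsGeneratedByCurve p.2 p.1 := Iff.rfl

/-- **`generatedPairs` is closed** in `C([0, ∞), ℂ) × C([0, ∞), ℝ)` (locally uniform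
convergence): this is [LSW04] Lemma 3.14 (both parts, `LawlerSchrammWerner2004_lemma314_maps_holds`
and `LawlerSchrammWerner2004_lemma314_kernel_holds`) in the form
`Loewner.isGeneratedByCurve_of_tendstoLocallyUniformly'`, the space being metrizable hence
sequential. [cite: LawlerSchrammWerner2004, Lemma 3.14] -/
theorem isClosed_generatedPairs : IsClosed generatedPairs := by
  refine IsSeqClosed.isClosed fun x p hx hlim ↦ ?_
  have h1 : Tendsto (fun n ↦ (x n).1) atTop (𝓝 p.1) := (continuous_fst.tendsto p).comp hlim
  have h2 : Tendsto (fun n ↦ (x n).2) atTop (𝓝 p.2) := (continuous_snd.tendsto p).comp hlim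
  rw [ContinuousMap.tendsto_iff_tendstoLocallyUniformly] at h1 h2
  exact Loewner.isGeneratedByCurve_of_tendstoLocallyUniformly' (fun n ↦ (x n).2.continuous)
    p.2.continuous h2 (fun n ↦ hx n) h1

/-- `generatedPairs` is a Borel set. [folklore] -/
theorem measurableSet_generatedPairs : MeasurableSet generatedPairs :=
  isClosed_generatedPairs.measurableSet

/-- The projection `(γ, W) ↦ W` is injective on `generatedPairs`: the generating curve of a
Loewner chain is unique (`Loewner.IsGeneratedByCurve.unique_holds`). Lawler (2005), §4.1.
[cite: Lawler2005, §4.1] -/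
theorem injOn_snd_generatedPairs : InjOn Prod.snd generatedPairs := by
  rintro ⟨γ, W⟩ h ⟨γ', W'⟩ h' (hW : W = W')
  subst hW
  have hγ : (γ : ℝ≥0 → ℂ) = γ' := Loewner.IsGeneratedByCurve.unique_holds W.continuous h h'
  rw [Prod.mk.injEq]
  exact ⟨ContinuousMap.ext fun t ↦ congrFun hγ t, rfl⟩

/-- **The set of driving paths whose chain is generated by a curve is Borel** in
`C([0, ∞), ℝ)`: it is the injective projection of the closed set `generatedPairs` of the Polish
space `C × C` (Lusin–Souslin, Mathlib `MeasurableSet.image_of_measurable_injOn`). Kechris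
(1995), Thm. 15.1. [folklore] -/
theorem measurableSet_snd_image_generatedPairs : MeasurableSet (Prod.snd '' generatedPairs) :=
  measurableSet_generatedPairs.image_of_measurable_injOn measurable_snd injOn_snd_generatedPairs

/-! ### The approximation criterion -/

section Criterion

variable {κ : ℝ≥0} {Ω : ℕ → Type*} [∀ n, MeasurableSpace (Ω n)] {P : ∀ n, Measure (Ω n)}
  [∀ n, IsProbabilityMeasure (P n)] {Γ : ∀ n, Ω n → C(ℝ≥0, ℂ)} {Ξ : ∀ n, Ω n → C(ℝ≥0, ℝ)}

/-- **The limit argument of [LSW04], proof of Thm. 4.7 (p. 981), abstract form.** Let `Γₙ` be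
random continuous curves and `Ξₙ` random continuous driving functions on probability spaces
`(Ωₙ, Pₙ)` such that (i) a.s. the chordal Loewner chain of `Ξₙ` is generated by `Γₙ`, (ii) the
laws of the `Γₙ` are tight on `C([0, ∞), ℂ)`, (iii) `Ξₙ → √κ B` in distribution on
`C([0, ∞), ℝ)` (Mathlib `TendstoInDistribution`, the limit being the SLE_κ driving path on the
canonical space). Then SLE_κ is a.s. generated by a curve. Proof: joint tightness and Prokhorov
give a subsequential weak limit `μ` of the laws of `(Γₙ, Ξₙ)`; `μ(generatedPairs) = 1` by the
portmanteau theorem (closed set, `isClosed_generatedPairs`); the `Ξ`-marginal of `μ` is the law of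
`√κ B`; the projection of `generatedPairs` is Borel (`measurableSet_snd_image_generatedPairs`) of
full measure, and this transports to the canonical space. [LSW04] p. 981 (with [LSW04] Thm. 4.4,
Prop. 4.5 and `κ = 8` this is the proof of Thm. 4.7). [cite: LawlerSchrammWerner2004, proof of Thm. 4.7] -/
theorem hasSLETrace_of_tendstoInDistribution [Fact Process.isProjectiveLimit_preWienerMeasure]
    (hΓ : ∀ n, AEMeasurable (Γ n) (P n))
    (hgen : ∀ n, ∀ᵐ ω ∂P n, Loewner.IsGeneratedByCurve (Ξ n ω) (Γ n ω))
    (htight : IsTightMeasureSet (Set.range fun n ↦ (P n).map (Γ n)))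
    (hlaw : TendstoInDistribution Ξ atTop (drivingPath κ) P Process.preWienerMeasure) :
    HasSLETrace κ := by
  classical
  -- complete separable metrics on the two path spaces (Polish), inducing the given topologies
  letI := upgradeIsCompletelyMetrizable C(ℝ≥0, ℂ)
  letI := upgradeIsCompletelyMetrizable C(ℝ≥0, ℝ)
  have hΞ : ∀ n, AEMeasurable (Ξ n) (P n) := hlaw.forall_aemeasurable
  have hpair : ∀ n, AEMeasurable (fun ω ↦ (Γ n ω, Ξ n ω)) (P n) := fun n ↦ (hΓ n).prodMk (hΞ n)
  -- the laws: joint, of the driving functions, and of the SLE_κ driving path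
  set μs : ℕ → ProbabilityMeasure (C(ℝ≥0, ℂ) × C(ℝ≥0, ℝ)) :=
    fun n ↦ ⟨(P n).map fun ω ↦ (Γ n ω, Ξ n ω), Measure.isProbabilityMeasure_map (hpair n)⟩
    with hμs
  set lawΞ : ℕ → ProbabilityMeasure C(ℝ≥0, ℝ) :=
    fun n ↦ ⟨(P n).map (Ξ n), Measure.isProbabilityMeasure_map (hΞ n)⟩ with hlawΞ
  set ν : ProbabilityMeasure C(ℝ≥0, ℝ) := ⟨Process.preWienerMeasure.map (drivingPath κ),
    Measure.isProbabilityMeasure_map (measurable_drivingPath κ).aemeasurable⟩ with hν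
  have hΞlim : Tendsto lawΞ atTop (𝓝 ν) := hlaw.tendsto
  have hfst : ∀ n, (μs n).toMeasure.fst = (P n).map (Γ n) := fun n ↦
    Measure.fst_map_prodMk₀ (hΞ n)
  have hsnd : ∀ n, (μs n).toMeasure.snd = (lawΞ n).toMeasure := fun n ↦
    Measure.snd_map_prodMk₀ (hΓ n)
  have hA1 : ∀ n, (μs n).toMeasure generatedPairs = 1 := fun n ↦ by
    change ((P n).map fun ω ↦ (Γ n ω, Ξ n ω)) generatedPairs = 1
    rw [Measure.map_apply_of_aemeasurable (hpair n) measurableSet_generatedPairs]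
    refine le_antisymm prob_le_one ?_
    rw [← measure_univ (μ := P n)]
    refine measure_mono_ae ?_
    filter_upwards [hgen n] with ω hω _
    exact hω
  -- joint tightness: the curve laws are tight by hypothesis, the driving laws because they converge
  have htight' : IsTightMeasureSet {x | ∃ μ ∈ Set.range μs, μ.toMeasure = x} := by
    have hset : {x | ∃ μ ∈ Set.range μs, μ.toMeasure = x} =
        Set.range fun n ↦ (μs n).toMeasure := by
      ext x
      simp only [mem_setOf_eq, mem_range, exists_exists_eq_and]
    rw [hset]
    refine IsTightMeasureSet.prodMk ?_ ?_
    · refine htight.subset ?_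
      rintro _ ⟨_, ⟨n, rfl⟩, rfl⟩
      exact ⟨n, (hfst n).symm⟩
    · have hcomp : IsCompact (closure (insert ν (Set.range lawΞ))) := by
        rw [(hΞlim.isCompact_insert_range).isClosed.closure_eq]
        exact hΞlim.isCompact_insert_range
      refine (isTightMeasureSet_of_isCompact_closure hcomp).subset ?_
      rintro _ ⟨_, ⟨n, rfl⟩, rfl⟩
      exact ⟨lawΞ n, mem_insert_of_mem _ (mem_range_self n), (hsnd n).symm⟩
  -- Prokhorov: a convergent subsequence of the joint laws
  obtain ⟨μ, -, σ, hσ, hconv⟩ := (isCompact_closure_of_isTightMeasureSet htight').tendsto_subseq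
    fun n ↦ subset_closure (mem_range_self n)
  -- the limit law charges the closed set `generatedPairs` fully (portmanteau)
  have hμA : μ.toMeasure generatedPairs = 1 := by
    have hle :=
      ProbabilityMeasure.limsup_measure_closed_le_of_tendsto hconv isClosed_generatedPairs
    have hlim : limsup (fun i ↦ ((μs ∘ σ) i).toMeasure generatedPairs) atTop = 1 := by
      simp only [Function.comp_apply, hA1, limsup_const]
    rw [hlim] at hle
    exact le_antisymm prob_le_one hle
  -- the `Ξ`-marginal of `μ` is the law `ν` of the SLE_κ driving path
  have hmarg : μ.toMeasure.map Prod.snd = ν.toMeasure := by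
    have h1 : Tendsto (fun i ↦ ((μs ∘ σ) i).map continuous_snd.measurable.aemeasurable) atTop
        (𝓝 (μ.map continuous_snd.measurable.aemeasurable)) :=
      ProbabilityMeasure.tendsto_map_of_tendsto_of_continuous _ _ hconv continuous_snd
    have h2 : (fun i ↦ ((μs ∘ σ) i).map continuous_snd.measurable.aemeasurable) = lawΞ ∘ σ := by
      funext i
      apply ProbabilityMeasure.toMeasure_injective
      rw [ProbabilityMeasure.toMeasure_map]
      exact hsnd (σ i)
    rw [h2] at h1
    have h4 := congrArg ProbabilityMeasure.toMeasure
      (tendsto_nhds_unique h1 (hΞlim.comp hσ.tendsto_atTop))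
    rwa [ProbabilityMeasure.toMeasure_map] at h4
  -- the Borel set of good driving paths has full `ν`-measure
  have hνG : ∀ᵐ W ∂ν.toMeasure, W ∈ Prod.snd '' generatedPairs := by
    rw [ae_iff, ← hmarg]
    change (Measure.map Prod.snd μ.toMeasure) (Prod.snd '' generatedPairs)ᶜ = 0
    rw [Measure.map_apply measurable_snd measurableSet_snd_image_generatedPairs.compl,
      ← nonpos_iff_eq_zero]
    have hsub : Prod.snd ⁻¹' (Prod.snd '' generatedPairs)ᶜ ⊆ generatedPairsᶜ :=
      fun p hp hpA ↦ hp ⟨p, hpA, rfl⟩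
    calc μ.toMeasure (Prod.snd ⁻¹' (Prod.snd '' generatedPairs)ᶜ)
        ≤ μ.toMeasure generatedPairsᶜ := measure_mono hsub
      _ = 0 := by rw [prob_compl_eq_one_sub measurableSet_generatedPairs, hμA, tsub_self]
  -- transport to the canonical space
  have hae : ∀ᵐ ω ∂Process.preWienerMeasure, drivingPath κ ω ∈ Prod.snd '' generatedPairs :=
    ae_of_ae_map (measurable_drivingPath κ).aemeasurable hνG
  filter_upwards [hae] with ω ⟨⟨γ, W⟩, hA, hW⟩
  refine ⟨γ, ?_⟩
  have hW' : (W : ℝ≥0 → ℝ) = sleDriving κ ω := by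
    rw [← coe_drivingPath κ ω, ← hW]
  rw [← hW']
  exact hA

end Criterion

/-! ### The junk branches of the canonical space, and the shape of the final assembly -/

/-- If the canonical Brownian motion is the junk zero process, SLE_κ has the zero driving
function and is generated by the curve `t ↦ 2i√t` (`hasSLETrace_zero`). [folklore] -/
theorem hasSLETrace_of_brownian_eq_zero {κ : ℝ≥0} (h : Process.brownian = 0) : HasSLETrace κ := by
  have hd : ∀ ω, sleDriving κ ω = sleDriving 0 ω := fun ω ↦ funext fun t ↦ by
    simp [sleDriving, h]
  have h0 := hasSLETrace_zero
  unfold HasSLETrace at h0 ⊢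
  simpa only [hd] using h0

/-- **Reduction of `HasSLETrace κ` to the non-degenerate canonical space.** It suffices to prove
`HasSLETrace κ` assuming that the pre-Wiener measure is the Kolmogorov extension of the Brownian
finite-dimensional laws (`Process.isProjectiveLimit_preWienerMeasure`, otherwise it is the zero
measure and the a.e. statement is void) and that the canonical Brownian motion exists
(`Process.exists_isBrownianReal_measurable_continuous`, otherwise `brownian = 0` and
`hasSLETrace_of_brownian_eq_zero` applies). This is the shape of the eventual discharge of
`hasSLETrace_eight` from `hasSLETrace_of_tendstoInDistribution`. [folklore] -/
theorem hasSLETrace_of_imp {κ : ℝ≥0}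
    (h : Process.isProjectiveLimit_preWienerMeasure →
      Process.exists_isBrownianReal_measurable_continuous → HasSLETrace κ) :
    HasSLETrace κ := by
  classical
  by_cases hB : Process.exists_isBrownianReal_measurable_continuous
  swap
  · refine hasSLETrace_of_brownian_eq_zero ?_
    unfold Process.brownian
    rw [dif_neg]
    exact hB
  by_cases hex : ∃ μ, IsProjectiveLimit (α := fun _ : ℝ≥0 ↦ ℝ) μ
      ProbabilityTheory.BrownianReal.projectiveFamily
  · refine h ?_ hB
    rw [Process.isProjectiveLimit_preWienerMeasure, Process.preWienerMeasure,
      Process.projectiveLimit, dif_pos hex]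
    exact hex.choose_spec
  · have h0 : Process.preWienerMeasure = 0 := by
      rw [Process.preWienerMeasure, Process.projectiveLimit, dif_neg hex]
    simp only [HasSLETrace, h0, ae_zero, eventually_bot]

/-! ### Identifying the limit law: any continuous Brownian motion scaled by `√κ` -/

/-- **The law on path space of `√κ B` does not depend on the Brownian motion `B`**: for any
Brownian motion `B` with continuous paths and measurable marginals on any probability space, the
law of `ω ↦ (t ↦ √κ Bₜ(ω)) ∈ C([0, ∞), ℝ)` is the law of the SLE_κ driving path of the canonical
space (given that the canonical Brownian motion exists). Both laws have the finite-dimensional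
distributions `(BrownianReal.projectiveFamily I).map (√κ ·)`, and laws on path space are
determined by them (`Process.measure_continuousMap_ext_of_fdd`). This is the bridge from a
driving-process convergence "to `B(κt)` / `√κ B(t)` for a standard Brownian motion `B`" (as in
[LSW04] Thm. 4.4) to the hypothesis of `hasSLETrace_of_tendstoInDistribution`.
Billingsley (1999), Example 1.3. [cite: Billingsley1999, Example 1.3] -/
theorem map_eq_map_drivingPath (κ : ℝ≥0) (hB : Process.exists_isBrownianReal_measurable_continuous)
    {Ω' : Type*} [MeasurableSpace Ω'] {Q : Measure Ω'} {B : ℝ≥0 → Ω' → ℝ}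
    (hBM : ProbabilityTheory.IsBrownianReal B Q) (hc : ∀ ω, Continuous (B · ω))
    (hm : ∀ t, Measurable (B t)) :
    Q.map (fun ω ↦ (⟨fun t ↦ Real.sqrt κ * B t ω, continuous_const.mul (hc ω)⟩ : C(ℝ≥0, ℝ))) =
      Process.preWienerMeasure.map (drivingPath κ) := by
  have hB' : ProbabilityTheory.IsBrownianReal Process.brownian Process.preWienerMeasure :=
    Process.isBrownianReal_brownian hB
  haveI : IsProbabilityMeasure Q := (hBM.hasLaw ∅).isProbabilityMeasure
  haveI : IsProbabilityMeasure Process.preWienerMeasure := (hB'.hasLaw ∅).isProbabilityMeasure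
  set Φ : Ω' → C(ℝ≥0, ℝ) := fun ω ↦ ⟨fun t ↦ Real.sqrt κ * B t ω, continuous_const.mul (hc ω)⟩
    with hΦ
  have hΦm : Measurable Φ :=
    Process.measurable_continuousMap_of_eval fun t ↦ (hm t).const_mul _
  haveI : IsFiniteMeasure (Q.map Φ) := Measure.isFiniteMeasure_map Q Φ
  refine Process.measure_continuousMap_ext_of_fdd fun I ↦ ?_
  have hsc : Measurable fun (v : I → ℝ) (i : I) ↦ Real.sqrt κ * v i :=
    measurable_pi_lambda _ fun i ↦ (measurable_pi_apply i).const_mul _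
  have hres : Measurable fun (f : C(ℝ≥0, ℝ)) (i : I) ↦ f i :=
    measurable_pi_lambda _ fun i ↦ (continuous_eval_const (i : ℝ≥0)).measurable
  rw [Measure.map_map hres hΦm, Measure.map_map hres (measurable_drivingPath κ)]
  have h1 : (fun (f : C(ℝ≥0, ℝ)) (i : I) ↦ f i) ∘ Φ =
      (fun (v : I → ℝ) (i : I) ↦ Real.sqrt κ * v i) ∘ fun ω ↦ I.restrict (B · ω) := rfl
  have h2 : (fun (f : C(ℝ≥0, ℝ)) (i : I) ↦ f i) ∘ drivingPath κ =
      (fun (v : I → ℝ) (i : I) ↦ Real.sqrt κ * v i) ∘ fun ω ↦ I.restrict (Process.brownian · ω) :=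
    rfl
  rw [h1, h2, ← Measure.map_map hsc (measurable_pi_lambda (fun ω ↦ I.restrict (B · ω)) fun i ↦ hm i),
    ← Measure.map_map hsc
      (measurable_pi_lambda (fun ω ↦ I.restrict (Process.brownian · ω)) fun i ↦
        Process.measurable_brownian i),
    (hBM.hasLaw I).map_eq, (hB'.hasLaw I).map_eq]

end Literature.Probability.RandomPlanarGeometry
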